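import Literature.NumberTheory.Transcendental.NesterenkoEliminationCharts
import Literature.NumberTheory.Transcendental.NesterenkoEliminationFactsProofs
import Literature.RingTheory.KrullDimension.AffineDimension
import Literature.RingTheory.MvPolynomial.HomogeneousDimension
import Mathlib.RingTheory.UniqueFactorizationDomain.Ideal
import Mathlib.Algebra.MvPolynomial.Funext
import HarnessLib

/-!
# The associated form of a homogeneous PRIME ideal (LNM 1752 Ch. 3 Prop. 4.4, prime case) — proofs

Topic `Literature/NumberTheory/Transcendental`. For a homogeneous prime ideal `𝔭 ⊂ ℚ[x₀, …, x_m]`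
with `dim ℚ[x̲] ⧸ 𝔭 = r ≥ 1` (projective dimension `r − 1 ≥ 0`) we prove that Nesterenko's
elimination ideal `p̄(r) = elimIdeal 𝔭 r ⊆ ℚ[u₁, …, u_r]` (LNM 1752 Ch. 3 Def. 4.3) is a NON-ZERO
PRINCIPAL PRIME ideal: `p̄(r) = (F)` with `F` irreducible (Nesterenko–Philippon (eds.), LNM 1752,
Ch. 3 Prop. 4.4, the case of a prime ideal; [Nes2] = Nesterenko, Izv. AN SSSR 41 (1977), §2).
The proof is ours and elementary, through the chart description of `NesterenkoEliminationCharts.lean`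
(`p̄(r) = σ_c⁻¹(𝔭' T)` for a chart `x_c ∉ 𝔭`, `mem_elimIdeal_iff_forall_sigmaU_mem`):

* `isPrime_elimIdeal_of_chart` — `p̄(r)` is prime (the contraction of the prime `𝔭' T`);
* `elimIdeal_ne_bot` — `p̄(r) ≠ 0` by counting transcendence degrees: `ℚ[U] ⧸ p̄(r)` embeds in
  `(ℚ[y] ⧸ 𝔭')[u_{ij} : j ≠ c]`, of transcendence degree `trdeg (ℚ[y] ⧸ 𝔭') + rm ≤ (r − 1) + rm`,
  less than the number `r(m + 1)` of variables `u_{ij}` (`trdeg ℚ[y] ⧸ 𝔭' < trdeg ℚ[x̲] ⧸ 𝔭 = r`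
  because `ℚ[y] ⧸ 𝔭'` is a proper quotient of the affine domain `ℚ[x̲] ⧸ 𝔭`, by `x_c − 1`);
* `elimIdeal_eq_bot_of_lt` — conversely `elimIdeal 𝔭 k = 0` for `k < r` ("`k` hyperplanes always
  meet `V(𝔭)`"): if `G ≠ 0` lay in it, pick rational coefficients `λ` with `G(λ) ≠ 0`; cutting `𝔭`
  successively by the `k` rational linear forms `Lᵢ(λ)` leaves a prime of dimension `≥ r − k ≥ 1`
  (`Literature.RingTheory.MvPolynomial.ringKrullDim_quotient_add_one_of_mem_minimalPrimes_sup_span`),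
  which has a non-zero complex zero `β` (projective Nullstellensatz, `projZeros_nonempty`); evaluating
  `G xⱼ^M ∈ (𝔭, L)` at `(λ, β)` gives `β = 0`;
* `eq_zero_of_rename_mem_elimIdeal` — hence no non-zero element of `p̄(r)` omits the variable
  `u_{rc}` (the same evaluation, solving `L_r(β) = 0` for the value of `u_{rc}`, which is possible
  as `β_c ≠ 0` for `λ` avoiding finitely many further hypersurfaces);
* `exists_irreducible_span_eq_elimIdeal`, `isPrincipal_elimIdeal_of_isPrime` — `p̄(r) = (F)`, `F`
  irreducible: a prime element
  `F ∈ p̄(r)` exists (UFD); if `(F) ⊊ p̄(r)` then `trdeg ℚ[U] ⧸ p̄(r) ≤ r(m+1) − 2`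
  (`Literature.RingTheory.KrullDimension.trdeg_quotient_lt`, twice), whereas the `r(m+1) − 1`
  variables other than `u_{rc}` are algebraically independent modulo `p̄(r)`.

No new definitions, no named facts.

## References

* [NesterenkoPhilippon2001] Yu. V. Nesterenko, P. Philippon (eds.), *Introduction to Algebraic
  Independence Theory*, LNM 1752, Springer 2001, Ch. 3 §4, Def. 4.3, Prop. 4.4 (p. 38).
* [Matsumura1987] H. Matsumura, *Commutative Ring Theory*, Thm 5.6 (`dim = trdeg`).
-/

noncomputable section

open MvPolynomial
open Literature.AlgebraicGeometry.Motives

attribute [local instance] MvPolynomial.gradedAlgebra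

namespace Literature.NumberTheory.Transcendental

namespace Nesterenko

variable {m : ℕ}

/-! ### Generalities -/

/-- The extension `I·A[σ]` of a prime ideal `I ⊂ A` to a polynomial ring is prime
(`A[σ] ⧸ I A[σ] ≅ (A ⧸ I)[σ]` is a domain). [folklore] -/
theorem isPrime_map_C {A σ : Type*} [CommRing A] {I : Ideal A} (hI : I.IsPrime) :
    (I.map (C : A →+* MvPolynomial σ A)).IsPrime := by
  have h : I.map (C : A →+* MvPolynomial σ A) =
      RingHom.ker (MvPolynomial.map (σ := σ) (Ideal.Quotient.mk I)) := by
    rw [MvPolynomial.ker_map, Ideal.mk_ker]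
  rw [h]
  haveI := hI
  exact RingHom.ker_isPrime _

/-- Cancelling a constant factor in `I·A[σ]`: if `a y ∈ I ⇒ a ∈ I` on `A`, then
`f · C y ∈ I A[σ] ⇒ f ∈ I A[σ]` (coefficientwise). [folklore] -/
theorem mem_map_C_of_mul_C_mem {A σ : Type*} [CommRing A] {I : Ideal A} {y : A}
    (hy : ∀ a, a * y ∈ I → a ∈ I) {f : MvPolynomial σ A}
    (h : f * C y ∈ I.map (C : A →+* MvPolynomial σ A)) : f ∈ I.map (C : A →+* MvPolynomial σ A) := by
  rw [mem_map_C_iff] at h ⊢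
  intro α
  have := h α
  rw [mul_comm, coeff_C_mul, mul_comm] at this
  exact hy _ this

/-- A homogeneous prime `𝔭` with `dim ℚ[x̲] ⧸ 𝔭 = r ≥ 1` does not contain all the variables: some
chart `x_c ∉ 𝔭` exists. [folklore] -/
theorem exists_X_notMem_of_rank {𝔭 : Ideal (Rx m)} (h𝔭 : 𝔭.IsPrime) {r : ℕ} (hr : 1 ≤ r)
    (hdim : ringKrullDim (Rx m ⧸ 𝔭) = r) : ∃ c, (X c : Rx m) ∉ 𝔭 := by
  haveI := h𝔭
  refine Literature.RingTheory.MvPolynomial.exists_X_notMem_of_ringKrullDim_ne_zero ?_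
  rw [hdim]
  have : (r : WithBot ℕ∞) ≠ 0 := by exact_mod_cast (show r ≠ 0 by omega)
  exact this

/-! ### `p̄(r)` is the contraction of `𝔭' T`; it is prime -/

/-- **`p̄(r) = σ_c⁻¹(𝔭'_c T)` for every chart `x_c ∉ 𝔭`** (any number `r` of linear forms): the
condition on the chart `c` alone implies the condition on all charts (charts `x_{c'} ∈ 𝔭` are
vacuous; for `x_{c'} ∉ 𝔭` apply `Σ_{c'}` to `G x_c^N ∈ (𝔭, L)` and cancel the power of
`x_c(x_{c'} := 1) ∉ 𝔭'_{c'}`). [cite: NesterenkoPhilippon2001, Ch. 3 Def. 4.3 (p. 38)] -/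
theorem elimIdeal_eq_comap_sigmaU {𝔭 : Ideal (Rx m)} (h𝔭 : 𝔭.IsPrime)
    (hhom : 𝔭.IsHomogeneous (homogeneousSubmodule (Fin (m + 1)) ℚ)) {c : Fin (m + 1)}
    (hc : (X c : Rx m) ∉ 𝔭) (r : ℕ) :
    elimIdeal 𝔭 r = ((affIdeal c 𝔭).map (C : Aff m →+* RT r m)).comap (sigmaU r m c) := by
  ext G
  rw [Ideal.mem_comap]
  refine ⟨fun hG => sigmaU_mem_of_mem_elimIdeal c hG, fun hG => ?_⟩
  rw [mem_elimIdeal_iff_forall_sigmaU_mem hhom]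
  intro c'
  by_cases hc' : (X c' : Rx m) ∈ 𝔭
  · rw [affIdeal_eq_top_of_X_mem c' hc', Ideal.map_top]
    exact Submodule.mem_top
  obtain ⟨N, -, hN⟩ := exists_mul_X_pow_mem_of_sigmaU_mem c hhom hG
  have h1 := map_sigmaUX_extIdeal_le r c' 𝔭 (Ideal.mem_map_of_mem (sigmaUX r m c') hN)
  have hx : sigmaUX r m c' (X (Sum.inr c)) = C (ProjectiveSpace.dehomogenize ℚ c' (X c)) := by
    simpa using sigmaUX_rename_inr r m c' (X c)
  rw [map_mul, map_pow, sigmaUX_rename_inl, hx, ← map_pow] at h1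
  have h𝔭' : (affIdeal c' 𝔭).IsPrime := isPrime_affIdeal h𝔭 hhom hc'
  refine mem_map_C_of_mul_C_mem (fun a ha => (h𝔭'.mem_or_mem ha).resolve_right fun h => ?_) h1
  have := h𝔭'.mem_of_pow_mem N h
  rw [dehomogenize_mem_affIdeal_iff_of_isPrime h𝔭 hhom hc' (isHomogeneous_X ℚ c)] at this
  exact hc this

/-- **`p̄(r)` is a prime ideal** for a homogeneous prime `𝔭` of positive rank
(LNM 1752 Ch. 3 Prop. 4.4: `F` is irreducible). [cite: NesterenkoPhilippon2001, Ch. 3 Prop. 4.4 (p. 38)] -/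
theorem isPrime_elimIdeal_of_chart {𝔭 : Ideal (Rx m)} (h𝔭 : 𝔭.IsPrime)
    (hhom : 𝔭.IsHomogeneous (homogeneousSubmodule (Fin (m + 1)) ℚ)) {c : Fin (m + 1)}
    (hc : (X c : Rx m) ∉ 𝔭) (r : ℕ) : (elimIdeal 𝔭 r).IsPrime := by
  rw [elimIdeal_eq_comap_sigmaU h𝔭 hhom hc r]
  haveI := isPrime_map_C (σ := Fin r × Fin m) (isPrime_affIdeal h𝔭 hhom hc)
  exact Ideal.IsPrime.comap _

/-! ### `p̄(r) ≠ 0`: counting transcendence degrees -/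

/-- `trdeg_ℚ (ℚ[y] ⧸ 𝔭') < r = dim ℚ[x̲] ⧸ 𝔭`: the affine coordinate ring of the chart is a proper
quotient (by an ideal containing the class of `x_c − 1 ∉ 𝔭`) of the affine domain `ℚ[x̲] ⧸ 𝔭`,
whose transcendence degree is its dimension `r`. [cite: Matsumura1987, Thm 5.6] -/
theorem trdeg_quotient_affIdeal_lt {𝔭 : Ideal (Rx m)} (h𝔭 : 𝔭.IsPrime)
    (hhom : 𝔭.IsHomogeneous (homogeneousSubmodule (Fin (m + 1)) ℚ)) {c : Fin (m + 1)}
    (hc : (X c : Rx m) ∉ 𝔭) {r : ℕ} (hdim : ringKrullDim (Rx m ⧸ 𝔭) = r) :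
    Algebra.trdeg ℚ (Aff m ⧸ affIdeal c 𝔭) < r := by
  haveI := h𝔭
  haveI h𝔭' : (affIdeal c 𝔭).IsPrime := isPrime_affIdeal h𝔭 hhom hc
  haveI : Algebra.FiniteType ℚ (Rx m ⧸ 𝔭) :=
    Algebra.FiniteType.of_surjective (Ideal.Quotient.mkₐ ℚ 𝔭) (Ideal.Quotient.mkₐ_surjective ℚ 𝔭)
  -- `π : ℚ[x̲] ⧸ 𝔭 → ℚ[y] ⧸ 𝔭'` induced by dehomogenisation
  let π₀ : Rx m →ₐ[ℚ] Aff m ⧸ affIdeal c 𝔭 :=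
    (Ideal.Quotient.mkₐ ℚ (affIdeal c 𝔭)).comp (ProjectiveSpace.dehomogenize ℚ c)
  have hπ₀ : ∀ P ∈ 𝔭, π₀ P = 0 := fun P hP => by
    simp only [π₀, AlgHom.comp_apply, Ideal.Quotient.mkₐ_eq_mk, Ideal.Quotient.eq_zero_iff_mem]
    exact dehomogenize_mem_affIdeal c hP
  let π : (Rx m ⧸ 𝔭) →ₐ[ℚ] Aff m ⧸ affIdeal c 𝔭 := Ideal.Quotient.liftₐ 𝔭 π₀ hπ₀
  have hπ₀surj : Function.Surjective π₀ :=
    (Ideal.Quotient.mkₐ_surjective ℚ _).comp (dehomogenize_surjective c)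
  have hπsurj : Function.Surjective π := by
    intro b
    obtain ⟨P, rfl⟩ := hπ₀surj b
    exact ⟨Ideal.Quotient.mk 𝔭 P, rfl⟩
  haveI h𝔮p : (RingHom.ker π).IsPrime := RingHom.ker_isPrime _
  have h𝔮ne : RingHom.ker π ≠ ⊥ := by
    intro h0
    have hmem : Ideal.Quotient.mk 𝔭 (X c - 1 : Rx m) ∈ RingHom.ker π := by
      rw [RingHom.mem_ker]
      change π₀ (X c - 1) = 0
      simp [π₀]
    rw [h0, Ideal.mem_bot, Ideal.Quotient.eq_zero_iff_mem] at hmem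
    have h1 := homogeneousComponent_mem_of_isHomogeneous hhom hmem 0
    rw [homogeneousComponent_zero, coeff_sub, coeff_zero_X, coeff_zero_one, zero_sub, C_neg, C_1,
      Ideal.neg_mem_iff] at h1
    exact h𝔭.ne_top ((Ideal.eq_top_iff_one _).mpr h1)
  -- the induced surjection `(ℚ[x̲] ⧸ 𝔭) ⧸ ker π → ℚ[y] ⧸ 𝔭'`
  let πbar : ((Rx m ⧸ 𝔭) ⧸ RingHom.ker π) →ₐ[ℚ] Aff m ⧸ affIdeal c 𝔭 :=
    Ideal.Quotient.liftₐ (RingHom.ker π) π fun a ha => ha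
  have hπbar : Function.Surjective πbar := by
    intro b
    obtain ⟨a, rfl⟩ := hπsurj b
    exact ⟨Ideal.Quotient.mk _ a, rfl⟩
  have hle := trdeg_le_of_surjective (R := ℚ) (A := (Rx m ⧸ 𝔭) ⧸ RingHom.ker π)
    (A' := Aff m ⧸ affIdeal c 𝔭) πbar hπbar
  have hlt := Literature.RingTheory.KrullDimension.trdeg_quotient_lt ℚ h𝔮ne
  obtain ⟨s, hs, ht⟩ :=
    Literature.RingTheory.KrullDimension.exists_ringKrullDim_eq_and_trdeg_eq ℚ (Rx m ⧸ 𝔭)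
  rw [hdim] at hs
  have hsr : s = r := by exact_mod_cast hs.symm
  rw [← hsr, ← ht]
  exact hle.trans_lt hlt

/-- **`p̄(r) ≠ 0`** for a homogeneous prime `𝔭` with `dim ℚ[x̲] ⧸ 𝔭 = r ≥ 1` ("`r` generic
hyperplanes miss the `(r−1)`-dimensional `V(𝔭)`"; LNM 1752 Ch. 3 Prop. 4.4: the associated form
exists). Proof: otherwise `ℚ[U] → (ℚ[y] ⧸ 𝔭')[u_{ij} : j ≠ c]`, `u ↦ σ_c(u)`, is injective, so the
`r(m+1)` variables `u_{ij}` are algebraically independent in an algebra of transcendence degree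
`trdeg (ℚ[y] ⧸ 𝔭') + rm < r + rm`. [cite: NesterenkoPhilippon2001, Ch. 3 Prop. 4.4 (p. 38)] -/
theorem elimIdeal_ne_bot {𝔭 : Ideal (Rx m)} (h𝔭 : 𝔭.IsPrime)
    (hhom : 𝔭.IsHomogeneous (homogeneousSubmodule (Fin (m + 1)) ℚ)) {r : ℕ} (hr : 1 ≤ r)
    (hdim : ringKrullDim (Rx m ⧸ 𝔭) = r) : elimIdeal 𝔭 r ≠ ⊥ := by
  classical
  obtain ⟨c, hc⟩ := exists_X_notMem_of_rank h𝔭 hr hdim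
  haveI h𝔭' : (affIdeal c 𝔭).IsPrime := isPrime_affIdeal h𝔭 hhom hc
  let D := MvPolynomial (Fin r × Fin m) (Aff m ⧸ affIdeal c 𝔭)
  let ψ : RT r m →ₐ[ℚ] D := MvPolynomial.mapAlgHom (Ideal.Quotient.mkₐ ℚ (affIdeal c 𝔭))
  have hkerψ : RingHom.ker ψ = (affIdeal c 𝔭).map (C : Aff m →+* RT r m) := by
    rw [MvPolynomial.ker_mapAlgHom]
    congr 1
    ext a
    rw [RingHom.mem_ker]
    exact Ideal.Quotient.eq_zero_iff_mem
  let φ : RU r m →ₐ[ℚ] D := ψ.comp (sigmaU r m c)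
  have hkerφ : RingHom.ker φ = elimIdeal 𝔭 r := by
    rw [elimIdeal_eq_comap_sigmaU h𝔭 hhom hc r, ← hkerψ]
    rfl
  intro hbot
  have hinj : Function.Injective φ := by
    rw [RingHom.injective_iff_ker_eq_bot, hkerφ, hbot]
  have hind : AlgebraicIndependent ℚ fun v : Fin r × Fin (m + 1) => φ (X v) := by
    rw [algebraicIndependent_iff_injective_aeval,
      show (fun v : Fin r × Fin (m + 1) => φ (X v)) = φ ∘ X from rfl, ← MvPolynomial.aeval_unique]
    exact hinj
  have h1 := hind.cardinalMk_le_trdeg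
  rw [Cardinal.mk_fintype, Fintype.card_prod, Fintype.card_fin, Fintype.card_fin] at h1
  -- `trdeg ℚ D = trdeg ℚ (ℚ[y]/𝔭') + rm`
  haveI : FaithfulSMul ℚ (Aff m ⧸ affIdeal c 𝔭) :=
    (faithfulSMul_iff_algebraMap_injective ℚ _).mpr (algebraMap ℚ (Aff m ⧸ affIdeal c 𝔭)).injective
  have h2 : Algebra.trdeg ℚ D =
      Algebra.trdeg ℚ (Aff m ⧸ affIdeal c 𝔭) + Algebra.trdeg (Aff m ⧸ affIdeal c 𝔭) D :=
    (trdeg_add_eq ℚ (Aff m ⧸ affIdeal c 𝔭) (A := D)).symm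
  have h3 : Algebra.trdeg (Aff m ⧸ affIdeal c 𝔭) D = (r * m : ℕ) := by
    change Algebra.trdeg _ (MvPolynomial (Fin r × Fin m) _) = _
    rw [MvPolynomial.trdeg_of_isDomain, Cardinal.mk_fintype, Fintype.card_prod, Fintype.card_fin,
      Fintype.card_fin, Cardinal.lift_natCast]
  have h4 := trdeg_quotient_affIdeal_lt h𝔭 hhom hc hdim
  -- `trdeg ℚ (ℚ[y]/𝔭')` is a natural number
  haveI : Algebra.FiniteType ℚ (Aff m ⧸ affIdeal c 𝔭) :=
    Algebra.FiniteType.of_surjective (Ideal.Quotient.mkₐ ℚ _) (Ideal.Quotient.mkₐ_surjective ℚ _)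
  obtain ⟨t, -, ht⟩ :=
    Literature.RingTheory.KrullDimension.exists_ringKrullDim_eq_and_trdeg_eq ℚ (Aff m ⧸ affIdeal c 𝔭)
  rw [h2, h3, ht] at h1
  rw [ht] at h4
  have h4' : t < r := by exact_mod_cast h4
  have h1' : r * (m + 1) ≤ t + r * m := by exact_mod_cast h1
  nlinarith

/-! ### Evaluation at complex points and `elimIdeal 𝔭 k = 0` for `k < r` -/

/-- Evaluating at constants commutes with `ℚ → ℂ`. [folklore] -/
theorem aeval_algebraMap_comp {τ : Type*} (lam : τ → ℚ) (G : MvPolynomial τ ℚ) :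
    aeval (fun v => algebraMap ℚ ℂ (lam v)) G = algebraMap ℚ ℂ (eval lam G) := by
  have : (aeval fun v => algebraMap ℚ ℂ (lam v)) = (Algebra.ofId ℚ ℂ).comp (aeval lam) :=
    MvPolynomial.algHom_ext fun v => by simp
  rw [this, AlgHom.comp_apply, Algebra.ofId_apply]
  rfl

/-- **Evaluation lemma.** If `G ∈ Ī(k)` for an ideal `J`, and a non-zero complex point `β` kills `J`
and all the linear forms `Lᵢ` with coefficients `u : ℂ^{k(m+1)}`, then `G(u) = 0`
(evaluate `G xⱼ^M ∈ (J, L₁, …, L_k)` at `(u, β)`). [cite: NesterenkoPhilippon2001, Ch. 3 Def. 4.3 (p. 38)] -/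
theorem aeval_eq_zero_of_mem_elimIdeal_of_forall_linForm {k : ℕ} {J : Ideal (Rx m)} {G : RU k m}
    (hG : G ∈ elimIdeal J k) (u : Fin k × Fin (m + 1) → ℂ) {β : Fin (m + 1) → ℂ}
    (hβJ : ∀ Q ∈ J, aeval β Q = 0) (hL : ∀ i, ∑ j, u (i, j) * β j = 0) (hβ : β ≠ 0) :
    aeval u G = 0 := by
  classical
  let ev : RUX k m →ₐ[ℚ] ℂ := aeval (Sum.elim u β)
  have hev : extIdeal J k ≤ RingHom.ker ev := by
    rw [extIdeal, sup_le_iff]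
    constructor
    · rw [Ideal.map_le_iff_le_comap]
      intro Q hQ
      rw [Ideal.mem_comap, RingHom.mem_ker]
      change ev (rename Sum.inr Q) = 0
      rw [aeval_rename]
      exact hβJ Q hQ
    · rw [Ideal.span_le]
      rintro _ ⟨i, rfl⟩
      rw [SetLike.mem_coe, RingHom.mem_ker]
      simp only [ev, linForm, map_sum, map_mul, aeval_X, Sum.elim_inl, Sum.elim_inr]
      exact hL i
  obtain ⟨M, hM, hGM⟩ := hG
  by_contra hne
  apply hβ
  funext j
  have h := hev (hGM j)
  rw [RingHom.mem_ker, map_mul, map_pow] at h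
  have hG' : ev (rename Sum.inl G) = aeval u G := by
    change aeval (Sum.elim u β) (rename Sum.inl G) = _
    rw [aeval_rename]
    rfl
  rw [hG', show ev (X (Sum.inr j)) = β j by simp [ev]] at h
  exact eq_zero_of_pow_eq_zero ((mul_eq_zero.mp h).resolve_left hne)

/-- **Cutting by `k` forms.** Let `𝔭 ⊆ 𝔪 = (x₀, …, x_m)` be prime with `dim ℚ[x̲] ⧸ 𝔭 = r` and let
`ℓ₁, …, ℓ_k` be polynomials without constant term. Then some prime `P ⊇ 𝔭 + (ℓ₁, …, ℓ_k)`,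
`P ⊆ 𝔪`, has `dim ℚ[x̲] ⧸ P ≥ r − k` (cut one form at a time: the dimension drops by at most one,
`Literature.RingTheory.MvPolynomial.ringKrullDim_quotient_add_one_of_mem_minimalPrimes_sup_span`).
[cite: Matsumura1987, Thm 13.5] -/
theorem exists_prime_le_ker_of_cuts {𝔭 : Ideal (Rx m)} (h𝔭 : 𝔭.IsPrime) {r : ℕ}
    (hdim : ringKrullDim (Rx m ⧸ 𝔭) = r)
    (h𝔭𝔪 : 𝔭 ≤ RingHom.ker (constantCoeff : Rx m →+* ℚ)) {k : ℕ} (ℓ : Fin k → Rx m)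
    (hℓ : ∀ i, constantCoeff (ℓ i) = 0) :
    ∃ P : Ideal (Rx m), P.IsPrime ∧ 𝔭 ≤ P ∧ (∀ i, ℓ i ∈ P) ∧
      P ≤ RingHom.ker (constantCoeff : Rx m →+* ℚ) ∧
      ∃ s : ℕ, ringKrullDim (Rx m ⧸ P) = s ∧ r ≤ s + k := by
  induction k with
  | zero => exact ⟨𝔭, h𝔭, le_rfl, fun i => i.elim0, h𝔭𝔪, r, hdim, le_rfl⟩
  | succ k ih =>
    obtain ⟨P₀, hP₀, h𝔭P₀, hℓP₀, hP₀𝔪, s, hs, hrs⟩ := ih (ℓ ∘ Fin.castSucc) (fun i => hℓ _)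
    by_cases hQ : ℓ (Fin.last k) ∈ P₀
    · refine ⟨P₀, hP₀, h𝔭P₀, fun i => ?_, hP₀𝔪, s, hs, by omega⟩
      rcases Fin.eq_castSucc_or_eq_last i with ⟨i', rfl⟩ | rfl
      · exact hℓP₀ i'
      · exact hQ
    · have hle : P₀ ⊔ Ideal.span {ℓ (Fin.last k)} ≤ RingHom.ker (constantCoeff : Rx m →+* ℚ) :=
        sup_le hP₀𝔪 ((Ideal.span_singleton_le_iff_mem _).mpr ((RingHom.mem_ker).mpr (hℓ _)))
      haveI := (Literature.RingTheory.MvPolynomial.isMaximal_ker_constantCoeff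
        (σ := Fin (m + 1)) (K := ℚ)).isPrime
      obtain ⟨P, hPmin, hP𝔪⟩ := Ideal.exists_minimalPrimes_le hle
      haveI := hP₀
      have hcut := Literature.RingTheory.MvPolynomial.ringKrullDim_quotient_add_one_of_mem_minimalPrimes_sup_span
        hQ hPmin
      have hPprime : P.IsPrime := hPmin.1.1
      haveI := hPprime
      haveI : Algebra.FiniteType ℚ (Rx m ⧸ P) :=
        Algebra.FiniteType.of_surjective (Ideal.Quotient.mkₐ ℚ P) (Ideal.Quotient.mkₐ_surjective ℚ P)
      obtain ⟨s', hs', -⟩ :=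
        Literature.RingTheory.KrullDimension.exists_ringKrullDim_eq_and_trdeg_eq ℚ (Rx m ⧸ P)
      rw [hs', hs] at hcut
      have hss : s' + 1 = s := by exact_mod_cast hcut
      refine ⟨P, hPprime, h𝔭P₀.trans (le_sup_left.trans hPmin.1.2), fun i => ?_, hP𝔪, s', hs',
        by omega⟩
      rcases Fin.eq_castSucc_or_eq_last i with ⟨i', rfl⟩ | rfl
      · exact (le_sup_left.trans hPmin.1.2) (hℓP₀ i')
      · exact hPmin.1.2 (Ideal.mem_sup_right (Ideal.mem_span_singleton_self _))

/-- The rational linear form `∑ⱼ λ_{ij} xⱼ` has no constant term. [folklore] -/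
theorem constantCoeff_sum_C_mul_X {k : ℕ} (lam : Fin k × Fin (m + 1) → ℚ) (i : Fin k) :
    constantCoeff (∑ j : Fin (m + 1), C (lam (i, j)) * X j : Rx m) = 0 := by
  simp [map_sum, constantCoeff_X]

/-- A non-zero rational polynomial does not vanish at some rational point. [folklore] -/
theorem exists_eval_ne_zero {τ : Type*} {G : MvPolynomial τ ℚ} (hG : G ≠ 0) :
    ∃ lam : τ → ℚ, eval lam G ≠ 0 := by
  by_contra h
  push Not at h
  exact hG (MvPolynomial.funext fun x => by rw [h x, map_zero])

/-- **`elimIdeal 𝔭 k = 0` for `k < r = dim ℚ[x̲] ⧸ 𝔭`**: `k` hyperplanes always meet the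
`(r − 1)`-dimensional projective variety `V(𝔭)` (a non-zero `G ∈ Ī(k)` would give rational forms
`Lᵢ(λ)`, `G(λ) ≠ 0`, cutting `V(𝔭)` in a variety of dimension `≥ r − 1 − k ≥ 0`, non-empty over `ℂ`,
contradicting the evaluation lemma). [cite: NesterenkoPhilippon2001, Ch. 3 Prop. 4.4 (p. 38)] -/
theorem elimIdeal_eq_bot_of_lt {𝔭 : Ideal (Rx m)} (h𝔭 : 𝔭.IsPrime)
    (hhom : 𝔭.IsHomogeneous (homogeneousSubmodule (Fin (m + 1)) ℚ)) {r k : ℕ}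
    (hdim : ringKrullDim (Rx m ⧸ 𝔭) = r) (hk : k < r) : elimIdeal 𝔭 k = ⊥ := by
  classical
  refine le_bot_iff.mp fun G hG => ?_
  rw [Ideal.mem_bot]
  by_contra hG0
  obtain ⟨lam, hlam⟩ := exists_eval_ne_zero hG0
  let ℓ : Fin k → Rx m := fun i => ∑ j, C (lam (i, j)) * X j
  have h𝔭𝔪 : 𝔭 ≤ RingHom.ker (constantCoeff : Rx m →+* ℚ) :=
    Literature.RingTheory.MvPolynomial.le_ker_constantCoeff_of_isHomogeneous hhom h𝔭.ne_top
  obtain ⟨P, hP, h𝔭P, hℓP, hP𝔪, s, hs, hrs⟩ :=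
    exists_prime_le_ker_of_cuts h𝔭 hdim h𝔭𝔪 ℓ (constantCoeff_sum_C_mul_X lam)
  obtain ⟨β, hβ⟩ := projZeros_nonempty P (by omega : 1 ≤ s) hP
    (fun Q hQ => (RingHom.mem_ker).mp (hP𝔪 hQ)) (isUnmixedOfRank_of_isPrime hP hs)
  have h := aeval_eq_zero_of_mem_elimIdeal_of_forall_linForm hG (fun v => algebraMap ℚ ℂ (lam v))
    (fun Q hQ => hβ.2 Q (h𝔭P hQ)) (fun i => ?_) hβ.1
  · rw [aeval_algebraMap_comp] at h
    exact hlam ((algebraMap ℚ ℂ).injective (by rw [h, map_zero]))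
  · have := hβ.2 (ℓ i) (hℓP i)
    simpa [ℓ, map_sum] using this

/-! ### No non-zero element of `p̄(r)` omits the variable `u_{rc}` -/

/-- For a homogeneous prime `P'` of rank `s`, a witness polynomial `g ≠ 0` on `ℚ^{s(m+1)}`: whenever
`g(λ) ≠ 0`, the `s` rational hyperplanes `Lᵢ(λ)` have no common non-zero complex zero on `V(P')`
(for `s ≥ 1` any non-zero element of `elimIdeal P' s`; for `s = 0`, `V(P') = ∅`). [folklore] -/
theorem exists_witness_projZeros_disjoint {P' : Ideal (Rx m)} (hP' : P'.IsPrime)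
    (hhom' : P'.IsHomogeneous (homogeneousSubmodule (Fin (m + 1)) ℚ)) {s : ℕ}
    (hdim' : ringKrullDim (Rx m ⧸ P') = s) :
    ∃ g : RU s m, g ≠ 0 ∧ ∀ lam : Fin s × Fin (m + 1) → ℚ, eval lam g ≠ 0 →
      ∀ β ∈ projZeros P', ¬ ∀ i : Fin s, ∑ j, algebraMap ℚ ℂ (lam (i, j)) * β j = 0 := by
  rcases Nat.eq_zero_or_pos s with rfl | hs
  · refine ⟨1, one_ne_zero, fun lam _ β hβ _ => hβ.1 (funext fun j => ?_)⟩
    obtain ⟨n, hn⟩ := Literature.RingTheory.MvPolynomial.exists_X_pow_mem_of_ringKrullDim_le_zero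
      hhom' (le_of_eq hdim') j
    have := hβ.2 _ (hP'.mem_of_pow_mem n hn)
    simpa using this
  · obtain ⟨g, hg, hg0⟩ := Submodule.exists_mem_ne_zero_of_ne_bot (elimIdeal_ne_bot hP' hhom' hs hdim')
    refine ⟨g, hg0, fun lam hlam β hβ hall => hlam ?_⟩
    have h := aeval_eq_zero_of_mem_elimIdeal_of_forall_linForm hg (fun v => algebraMap ℚ ℂ (lam v)) hβ.2 hall hβ.1
    rw [aeval_algebraMap_comp] at h
    exact (algebraMap ℚ ℂ).injective (by rw [h, map_zero])

/-- **No non-zero `G ∈ p̄(r)` omits `u_{rc}`** (`𝔭` a homogeneous prime, `dim ℚ[x̲] ⧸ 𝔭 = r = s + 1`,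
`x_c ∉ 𝔭`): writing `G = H(u_{ij} : (i, j) ≠ (r, c))`, if `H ≠ 0` choose rational values `λ'`
of these variables with `H(λ') ≠ 0` and avoiding the witnesses of the minimal primes of
`𝔭 + (x_c)` (`exists_witness_projZeros_disjoint`); the `s` rational hyperplanes
`L₁(λ'), …, L_s(λ')` meet `V(𝔭)` in some `β ≠ 0` (cutting, `exists_prime_le_ker_of_cuts`, and the
projective Nullstellensatz), necessarily with `β_c ≠ 0`; then the value of `u_{rc}` can be chosen
in `ℂ` so that also `L_r(β) = 0`, and the evaluation lemma gives `H(λ') = 0`.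
[cite: NesterenkoPhilippon2001, Ch. 3 Prop. 4.4 (p. 38)] -/
theorem eq_zero_of_rename_mem_elimIdeal {𝔭 : Ideal (Rx m)} (h𝔭 : 𝔭.IsPrime)
    (hhom : 𝔭.IsHomogeneous (homogeneousSubmodule (Fin (m + 1)) ℚ)) {s : ℕ}
    (hdim : ringKrullDim (Rx m ⧸ 𝔭) = (s + 1 : ℕ)) {c : Fin (m + 1)} (hc : (X c : Rx m) ∉ 𝔭)
    (H : MvPolynomial {v : Fin (s + 1) × Fin (m + 1) // v ≠ (Fin.last s, c)} ℚ)
    (hH : rename Subtype.val H ∈ elimIdeal 𝔭 (s + 1)) : H = 0 := by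
  classical
  by_contra hH0
  -- the bad primes: minimal primes of `𝔭 + (x_c)`, each homogeneous of rank `s`
  set J : Ideal (Rx m) := 𝔭 ⊔ Ideal.span {(X c : Rx m)} with hJ
  have hJhom : J.IsHomogeneous (homogeneousSubmodule (Fin (m + 1)) ℚ) :=
    hhom.sup (Ideal.homogeneous_span _ _ fun x hx => by
      rw [Set.mem_singleton_iff] at hx; subst hx; exact ⟨1, isHomogeneous_X ℚ c⟩)
  have hfin := J.finite_minimalPrimes_of_isNoetherianRing
  haveI := h𝔭
  have hbad : ∀ P' ∈ J.minimalPrimes, P'.IsPrime ∧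
      P'.IsHomogeneous (homogeneousSubmodule (Fin (m + 1)) ℚ) ∧ ringKrullDim (Rx m ⧸ P') = s := by
    intro P' hP'
    have hprime : P'.IsPrime := hP'.1.1
    refine ⟨hprime, Literature.RingTheory.MvPolynomial.isHomogeneous_of_mem_minimalPrimes hJhom hP', ?_⟩
    have hcut := Literature.RingTheory.MvPolynomial.ringKrullDim_quotient_add_one_of_mem_minimalPrimes_sup_span
      hc hP'
    haveI := hprime
    haveI : Algebra.FiniteType ℚ (Rx m ⧸ P') :=
      Algebra.FiniteType.of_surjective (Ideal.Quotient.mkₐ ℚ P') (Ideal.Quotient.mkₐ_surjective ℚ P')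
    obtain ⟨s', hs', -⟩ :=
      Literature.RingTheory.KrullDimension.exists_ringKrullDim_eq_and_trdeg_eq ℚ (Rx m ⧸ P')
    rw [hs', hdim] at hcut
    have : s' + 1 = s + 1 := by exact_mod_cast hcut
    rw [hs']
    congr 1
    exact_mod_cast (by omega : s' = s)
  choose g hg0 hg using fun P' (hP' : P' ∈ J.minimalPrimes) =>
    exists_witness_projZeros_disjoint (hbad P' hP').1 (hbad P' hP').2.1 (hbad P' hP').2.2
  -- embedding of the first `s` blocks into the variables `≠ (last, c)`
  let ι : Fin s × Fin (m + 1) → {v : Fin (s + 1) × Fin (m + 1) // v ≠ (Fin.last s, c)} :=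
    fun v => ⟨(Fin.castSucc v.1, v.2), fun h => (Fin.castSucc_lt_last v.1).ne (Prod.mk.inj h).1⟩
  have hι : Function.Injective ι := fun v w h => by
    have h' := congrArg Subtype.val h
    simp only [ι, Prod.mk.injEq, Fin.castSucc_inj] at h'
    exact Prod.ext h'.1 h'.2
  -- choose `λ'` with `H(λ') ≠ 0` and `g_{P'}(λ'∘ι) ≠ 0` for all bad `P'`
  set Pf : MvPolynomial {v : Fin (s + 1) × Fin (m + 1) // v ≠ (Fin.last s, c)} ℚ :=
    H * ∏ P' ∈ hfin.toFinset.attach, rename ι (g P'.1 (hfin.mem_toFinset.mp P'.2)) with hPf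
  have hPf0 : Pf ≠ 0 := by
    refine mul_ne_zero hH0 (Finset.prod_ne_zero_iff.mpr fun P' _ => ?_)
    exact (map_ne_zero_iff _ (rename_injective ι hι)).mpr (hg0 _ _)
  obtain ⟨lam', hlam'⟩ := exists_eval_ne_zero hPf0
  rw [hPf, map_mul, map_prod] at hlam'
  have hHlam : eval lam' H ≠ 0 := left_ne_zero_of_mul hlam'
  have hglam : ∀ P' (hP' : P' ∈ J.minimalPrimes), eval (lam' ∘ ι) (g P' hP') ≠ 0 := by
    intro P' hP'
    have h := (Finset.prod_ne_zero_iff.mp (right_ne_zero_of_mul hlam'))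
      ⟨P', hfin.mem_toFinset.mpr hP'⟩ (Finset.mem_attach _ _)
    rwa [eval_rename] at h
  -- cut `𝔭` by the `s` rational forms `Lᵢ(λ')`, `i < s`
  set lam : Fin s × Fin (m + 1) → ℚ := lam' ∘ ι with hlam
  let ℓ : Fin s → Rx m := fun i => ∑ j, C (lam (i, j)) * X j
  have h𝔭𝔪 : 𝔭 ≤ RingHom.ker (constantCoeff : Rx m →+* ℚ) :=
    Literature.RingTheory.MvPolynomial.le_ker_constantCoeff_of_isHomogeneous hhom h𝔭.ne_top
  obtain ⟨P, hP, h𝔭P, hℓP, hP𝔪, t, ht, hrt⟩ :=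
    exists_prime_le_ker_of_cuts h𝔭 hdim h𝔭𝔪 ℓ (constantCoeff_sum_C_mul_X lam)
  obtain ⟨β, hβ⟩ := projZeros_nonempty P (by omega : 1 ≤ t) hP
    (fun Q hQ => (RingHom.mem_ker).mp (hP𝔪 hQ)) (isUnmixedOfRank_of_isPrime hP ht)
  have hℓβ : ∀ i : Fin s, ∑ j, algebraMap ℚ ℂ (lam (i, j)) * β j = 0 := fun i => by
    have := hβ.2 (ℓ i) (hℓP i)
    simpa [ℓ, map_sum] using this
  -- `β_c ≠ 0`
  have hβc : β c ≠ 0 := by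
    intro hβc
    have hβJ : J ≤ RingHom.ker (aeval β : Rx m →ₐ[ℚ] ℂ) := by
      refine sup_le (fun Q hQ => (RingHom.mem_ker).mpr (hβ.2 Q (h𝔭P hQ))) ?_
      rw [Ideal.span_singleton_le_iff_mem, RingHom.mem_ker, aeval_X]
      exact hβc
    haveI : (RingHom.ker (aeval β : Rx m →ₐ[ℚ] ℂ)).IsPrime := RingHom.ker_isPrime _
    obtain ⟨P', hP', hP'le⟩ := Ideal.exists_minimalPrimes_le hβJ
    have hβP' : β ∈ projZeros P' := ⟨hβ.1, fun Q hQ => (RingHom.mem_ker).mp (hP'le hQ)⟩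
    exact hg P' hP' lam (hglam P' hP') β hβP' hℓβ
  -- the value of `u_{rc}` making `L_r(β) = 0`
  let μ : ℂ := -(∑ j : Fin m, algebraMap ℚ ℂ (lam' ⟨(Fin.last s, c.succAbove j),
      fun h => Fin.succAbove_ne c j (Prod.mk.inj h).2⟩) * β (c.succAbove j)) / β c
  let u : Fin (s + 1) × Fin (m + 1) → ℂ := fun v =>
    if h : v = (Fin.last s, c) then μ else algebraMap ℚ ℂ (lam' ⟨v, h⟩)
  have hu : ∀ w : {v : Fin (s + 1) × Fin (m + 1) // v ≠ (Fin.last s, c)}, u w.1 = algebraMap ℚ ℂ (lam' w) :=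
    fun w => by simp only [u, dif_neg w.2]
  have hL : ∀ i, ∑ j, u (i, j) * β j = 0 := by
    intro i
    rcases Fin.eq_castSucc_or_eq_last i with ⟨i', rfl⟩ | rfl
    · have : ∀ j, u (Fin.castSucc i', j) = algebraMap ℚ ℂ (lam (i', j)) := fun j => hu (ι (i', j))
      simp only [this]
      exact hℓβ i'
    · rw [Fin.sum_univ_succAbove _ c]
      have h1 : u (Fin.last s, c) = μ := by simp [u]
      have h2 : ∀ j, u (Fin.last s, c.succAbove j) = algebraMap ℚ ℂ (lam' ⟨(Fin.last s, c.succAbove j),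
          fun h => Fin.succAbove_ne c j (Prod.mk.inj h).2⟩) := fun j =>
        hu ⟨(Fin.last s, c.succAbove j), _⟩
      simp only [h1, h2]
      rw [show μ * β c = -(∑ j : Fin m, algebraMap ℚ ℂ (lam' ⟨(Fin.last s, c.succAbove j),
          fun h => Fin.succAbove_ne c j (Prod.mk.inj h).2⟩) * β (c.succAbove j)) from
        div_mul_cancel₀ _ hβc, neg_add_cancel]
  have h := aeval_eq_zero_of_mem_elimIdeal_of_forall_linForm hH u (fun Q hQ => hβ.2 Q (h𝔭P hQ)) hL hβ.1
  rw [aeval_rename, show u ∘ Subtype.val = fun w => algebraMap ℚ ℂ (lam' w) from funext hu,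
    aeval_algebraMap_comp] at h
  exact hHlam ((algebraMap ℚ ℂ).injective (by rw [h, map_zero]))

/-! ### `p̄(r)` is principal -/

/-- The number of variables `u_{ij}` other than `u_{rc}`. [folklore] -/
theorem card_ne_last (s m : ℕ) (c : Fin (m + 1)) :
    Fintype.card {v : Fin (s + 1) × Fin (m + 1) // v ≠ (Fin.last s, c)} = (s + 1) * (m + 1) - 1 := by
  classical
  have h := Fintype.card_subtype_compl (fun v : Fin (s + 1) × Fin (m + 1) => v = (Fin.last s, c))
  simp only [Fintype.card_prod, Fintype.card_fin, Fintype.card_subtype_eq] at h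
  exact h

/-- **LNM 1752 Ch. 3 Prop. 4.4, prime case: `p̄(r) = (F)` with `F` irreducible.** For a
homogeneous prime `𝔭 ⊂ ℚ[x₀, …, x_m]` with `dim ℚ[x̲] ⧸ 𝔭 = r ≥ 1`, the ideal `Ī(r) = p̄(r)` of
`ℚ[u₁, …, u_r]` is generated by an irreducible polynomial (the associated / Chow / Cayley form of
`𝔭`). Proof: `p̄(r)` is a non-zero prime of the factorial ring `ℚ[U]`, so it contains a prime
element `F`; if `(F) ≠ p̄(r)`, two successive proper prime quotients give
`trdeg ℚ[U] ⧸ p̄(r) ≤ r(m+1) − 2`, but the `r(m+1) − 1` variables other than `u_{rc}` stay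
algebraically independent modulo `p̄(r)` (`eq_zero_of_rename_mem_elimIdeal`).
[cite: NesterenkoPhilippon2001, Ch. 3 Prop. 4.4 (p. 38)] -/
theorem exists_irreducible_span_eq_elimIdeal {𝔭 : Ideal (Rx m)} (h𝔭 : 𝔭.IsPrime)
    (hhom : 𝔭.IsHomogeneous (homogeneousSubmodule (Fin (m + 1)) ℚ)) {r : ℕ} (hr : 1 ≤ r)
    (hdim : ringKrullDim (Rx m ⧸ 𝔭) = r) :
    ∃ F : RU r m, Irreducible F ∧ Ideal.span {F} = elimIdeal 𝔭 r := by
  classical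
  obtain ⟨s, rfl⟩ : ∃ s, r = s + 1 := ⟨r - 1, by omega⟩
  obtain ⟨c, hc⟩ := exists_X_notMem_of_rank h𝔭 hr hdim
  have hprime : (elimIdeal 𝔭 (s + 1)).IsPrime := isPrime_elimIdeal_of_chart h𝔭 hhom hc (s + 1)
  have hne : elimIdeal 𝔭 (s + 1) ≠ ⊥ := elimIdeal_ne_bot h𝔭 hhom hr hdim
  obtain ⟨F, hFp, hF⟩ := hprime.exists_mem_prime_of_ne_bot hne
  refine ⟨F, hF.irreducible, ?_⟩
  by_contra hneq
  have hle : Ideal.span {F} ≤ elimIdeal 𝔭 (s + 1) := (Ideal.span_singleton_le_iff_mem _).mpr hFp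
  have hlt : Ideal.span {F} < elimIdeal 𝔭 (s + 1) := lt_of_le_of_ne hle hneq
  haveI hFprime : (Ideal.span {F}).IsPrime := (Ideal.span_singleton_prime hF.ne_zero).mpr hF
  haveI := hprime
  -- the non-zero prime `𝔮 = p̄(r) ⧸ (F)` of the affine domain `ℚ[U] ⧸ (F)`
  set 𝔮 : Ideal (RU (s + 1) m ⧸ Ideal.span {F}) :=
    (elimIdeal 𝔭 (s + 1)).map (Ideal.Quotient.mkₐ ℚ (Ideal.span {F})) with h𝔮
  haveI h𝔮p : 𝔮.IsPrime := by
    refine Ideal.map_isPrime_of_surjective (Ideal.Quotient.mkₐ_surjective ℚ _) fun G hG => hle ?_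
    rwa [RingHom.mem_ker, Ideal.Quotient.mkₐ_eq_mk, Ideal.Quotient.eq_zero_iff_mem] at hG
  have h𝔮ne : 𝔮 ≠ ⊥ := by
    intro h0
    apply not_le_of_gt hlt
    intro G hG
    have : Ideal.Quotient.mkₐ ℚ (Ideal.span {F}) G ∈ 𝔮 := Ideal.mem_map_of_mem _ hG
    rwa [h0, Ideal.mem_bot, Ideal.Quotient.mkₐ_eq_mk, Ideal.Quotient.eq_zero_iff_mem] at this
  haveI : Algebra.FiniteType ℚ (RU (s + 1) m ⧸ Ideal.span {F}) :=
    Algebra.FiniteType.of_surjective (Ideal.Quotient.mkₐ ℚ _) (Ideal.Quotient.mkₐ_surjective ℚ _)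
  haveI : Algebra.FiniteType ℚ ((RU (s + 1) m ⧸ Ideal.span {F}) ⧸ 𝔮) :=
    Algebra.FiniteType.of_surjective (Ideal.Quotient.mkₐ ℚ _) (Ideal.Quotient.mkₐ_surjective ℚ _)
  haveI : Algebra.FiniteType ℚ (RU (s + 1) m ⧸ elimIdeal 𝔭 (s + 1)) :=
    Algebra.FiniteType.of_surjective (Ideal.Quotient.mkₐ ℚ _) (Ideal.Quotient.mkₐ_surjective ℚ _)
  -- (1) `trdeg ((ℚ[U]/(F))/𝔮) + 2 ≤ r(m+1)`
  have h1 := Literature.RingTheory.KrullDimension.trdeg_quotient_lt ℚ h𝔮ne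
  have h2 := Literature.RingTheory.KrullDimension.trdeg_quotient_lt ℚ
    (A := RU (s + 1) m) (𝔭 := Ideal.span {F})
    (by rw [Ne, Ideal.span_singleton_eq_bot]; exact hF.ne_zero : _ ≠ ⊥)
  have h3 : Algebra.trdeg ℚ (RU (s + 1) m) = ((s + 1) * (m + 1) : ℕ) := by
    change Algebra.trdeg ℚ (MvPolynomial (Fin (s + 1) × Fin (m + 1)) ℚ) = _
    rw [MvPolynomial.trdeg_of_isDomain, Cardinal.mk_fintype, Fintype.card_prod, Fintype.card_fin,
      Fintype.card_fin, Cardinal.lift_natCast]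
  obtain ⟨n₁, -, hn₁⟩ := Literature.RingTheory.KrullDimension.exists_ringKrullDim_eq_and_trdeg_eq ℚ
    ((RU (s + 1) m ⧸ Ideal.span {F}) ⧸ 𝔮)
  obtain ⟨n₂, -, hn₂⟩ := Literature.RingTheory.KrullDimension.exists_ringKrullDim_eq_and_trdeg_eq ℚ
    (RU (s + 1) m ⧸ Ideal.span {F})
  rw [hn₁, hn₂] at h1
  rw [hn₂, h3] at h2
  have h1' : n₁ < n₂ := by exact_mod_cast h1
  have h2' : n₂ < (s + 1) * (m + 1) := by exact_mod_cast h2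
  -- (2) `trdeg (ℚ[U]/p̄) ≤ trdeg ((ℚ[U]/(F))/𝔮)` (they are isomorphic)
  let e := DoubleQuot.quotQuotEquivQuotOfLEₐ ℚ hle
  have h4 := trdeg_le_of_surjective (R := ℚ) (A := (RU (s + 1) m ⧸ Ideal.span {F}) ⧸ 𝔮)
    (A' := RU (s + 1) m ⧸ elimIdeal 𝔭 (s + 1)) (e : _ →ₐ[ℚ] _) e.surjective
  -- (3) the `r(m+1) − 1` variables `≠ (last, c)` are independent modulo `p̄`
  let ψ : MvPolynomial {v : Fin (s + 1) × Fin (m + 1) // v ≠ (Fin.last s, c)} ℚ →ₐ[ℚ]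
      RU (s + 1) m ⧸ elimIdeal 𝔭 (s + 1) :=
    (Ideal.Quotient.mkₐ ℚ _).comp (rename Subtype.val)
  have hψ : Function.Injective ψ := by
    rw [injective_iff_map_eq_zero]
    intro H hH
    refine eq_zero_of_rename_mem_elimIdeal h𝔭 hhom hdim hc H ?_
    rwa [AlgHom.comp_apply, Ideal.Quotient.mkₐ_eq_mk, Ideal.Quotient.eq_zero_iff_mem] at hH
  have h5 := trdeg_le_of_injective (R := ℚ)
    (A := MvPolynomial {v : Fin (s + 1) × Fin (m + 1) // v ≠ (Fin.last s, c)} ℚ)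
    (A' := RU (s + 1) m ⧸ elimIdeal 𝔭 (s + 1)) ψ hψ
  have h6 : Algebra.trdeg ℚ (MvPolynomial {v : Fin (s + 1) × Fin (m + 1) // v ≠ (Fin.last s, c)} ℚ) =
      ((s + 1) * (m + 1) - 1 : ℕ) := by
    rw [MvPolynomial.trdeg_of_isDomain, Cardinal.mk_fintype, card_ne_last, Cardinal.lift_natCast]
  obtain ⟨n₀, -, hn₀⟩ := Literature.RingTheory.KrullDimension.exists_ringKrullDim_eq_and_trdeg_eq ℚ
    (RU (s + 1) m ⧸ elimIdeal 𝔭 (s + 1))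
  rw [hn₀, hn₁] at h4
  rw [h6, hn₀] at h5
  have h4' : n₀ ≤ n₁ := by exact_mod_cast h4
  have h5' : (s + 1) * (m + 1) - 1 ≤ n₀ := by exact_mod_cast h5
  have hpos : 0 < (s + 1) * (m + 1) := Nat.mul_pos (Nat.succ_pos s) (Nat.succ_pos m)
  omega

/-- Hence **`p̄(r)` is a non-zero principal prime ideal** (LNM 1752 Ch. 3 Prop. 4.4, prime case).
[cite: NesterenkoPhilippon2001, Ch. 3 Prop. 4.4 (p. 38)] -/
theorem isPrincipal_elimIdeal_of_isPrime {𝔭 : Ideal (Rx m)} (h𝔭 : 𝔭.IsPrime)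
    (hhom : 𝔭.IsHomogeneous (homogeneousSubmodule (Fin (m + 1)) ℚ)) {r : ℕ} (hr : 1 ≤ r)
    (hdim : ringKrullDim (Rx m ⧸ 𝔭) = r) : (elimIdeal 𝔭 r).IsPrincipal := by
  obtain ⟨F, -, hF⟩ := exists_irreducible_span_eq_elimIdeal h𝔭 hhom hr hdim
  exact ⟨F, by rw [← hF, Ideal.submodule_span_eq]⟩

/-- Every generator of `p̄(r)` is irreducible (it generates a non-zero prime ideal).
[cite: NesterenkoPhilippon2001, Ch. 3 Prop. 4.4 (p. 38)] -/
theorem irreducible_of_span_eq_elimIdeal {𝔭 : Ideal (Rx m)} (h𝔭 : 𝔭.IsPrime)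
    (hhom : 𝔭.IsHomogeneous (homogeneousSubmodule (Fin (m + 1)) ℚ)) {r : ℕ} (hr : 1 ≤ r)
    (hdim : ringKrullDim (Rx m ⧸ 𝔭) = r) {F : RU r m} (hF : Ideal.span {F} = elimIdeal 𝔭 r) :
    Irreducible F := by
  obtain ⟨c, hc⟩ := exists_X_notMem_of_rank h𝔭 hr hdim
  have hprime : (Ideal.span {F}).IsPrime := hF ▸ isPrime_elimIdeal_of_chart h𝔭 hhom hc r
  have hF0 : F ≠ 0 := by
    intro h0
    apply elimIdeal_ne_bot h𝔭 hhom hr hdim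
    rw [← hF, h0, Ideal.span_singleton_eq_bot]
  exact ((Ideal.span_singleton_prime hF0).mp hprime).irreducible

end Nesterenko

end Literature.NumberTheory.Transcendental
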